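import Literature.AnabelianGeometry.AbsoluteAnabelian.AbsTopISemiAbsolute
import Literature.AnabelianGeometry.AbsoluteAnabelian.AbsAnabFundamentalGroupsProofs
import Literature.AnabelianGeometry.AbsoluteAnabelian.MLFGaloisGroups
import Mathlib.RingTheory.Polynomial.Cyclotomic.Roots
import Mathlib.RingTheory.RootsOfUnity.AlgebraicallyClosed
import HarnessLib

/-!
# [AbsTopI] Thm 2.6 (vi): `Δ` is the maximal tfg closed normal subgroup, and `Π` is not tfg,
# over a number field — the printed deductions from [AbsAnab] Thm 1.1.2

S. Mochizuki, *Topics in Absolute Anabelian Geometry I: Generalities* (2012) [AbsTopI], Thm 2.6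
(vi) p. 22 (manuscript pagination, lit key paper:url-11ac98ba15fc): for `k` an NF, "the kernel of
the quotient `Π ↠ G` may be characterized ["group-theoretically"] as the maximal topologically
finitely generated closed normal subgroup of `Π`.  In particular, `Π` is not topologically finitely
generated."  The statement file `AbsTopISemiAbsolute.lean` (abc-iut-L4-t4, adopted by L4-t14)
records these two sentences, for ALL abstract extensions `1 → Δ → Π → G_F → 1` with `Δ`
topologically finitely generated, as the closed named facts `FundamentalExtension.thm26_vi_maximal`
("a formal consequence of [AbsAnab] Thm 1.1.2 = [FJ] 15.10, as in [AbsAnab] Lemma 1.1.4 (i)") and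
`FundamentalExtension.thm26_vi_not_tfg`.

This proof-only companion DEDUCES both from the named fact `galoisNF_tfgNormalSubgroup_trivial`
([AbsAnab] Thm 1.1.2, `MLFGaloisGroups.lean`): the first is the case `Π′ = Π` of
`geomIsMaxTFGNormalIn_of_tfgNormalSubgroup_trivial` (`AbsAnabFundamentalGroupsProofs.lean`); for
the second, if `Π` were tfg then so would be `G ≅ G_F`, a tfg closed normal subgroup of itself,
hence trivial by Thm 1.1.2 — but `G_F ≠ 1` for a number field (`F̄ ∌` a primitive `p`-th root of
unity once `p - 1 > [F : ℚ]`; PROVED here).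

Proof-only: no definition is introduced; nothing of the statement files is restated.  HONEST
FRAMING: CONDITIONAL discharges (Thm 1.1.2 stays a named fact); no bearing on Cor. 3.12.
-/

noncomputable section

namespace Literature.AnabelianGeometry.AbsoluteAnabelian

open Field

/-- The absolute Galois group of a number field is nontrivial: for a prime `p` with
`p - 1 > [F : ℚ]`, a primitive `p`-th root of unity of `F̄` does not lie in `F` (its minimal
polynomial over `ℚ` is the `p`-th cyclotomic polynomial, of degree `p - 1`), so it is moved by
some element of `Gal(F̄/F)` (`F̄/F` is Galois). [folklore] -/
private theorem exists_ne_one_absoluteGaloisGroup (F : Type) [Field F] [NumberField F] :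
    ∃ σ : absoluteGaloisGroup F, σ ≠ 1 := by
  by_contra hall
  simp only [ne_eq, not_exists, not_not] at hall
  obtain ⟨p, hpge, hp⟩ := Nat.exists_infinite_primes (Module.finrank ℚ F + 2)
  haveI := Fact.mk hp
  haveI : NeZero ((p : ℕ) : F) := ⟨Nat.cast_ne_zero.mpr hp.ne_zero⟩
  obtain ⟨ζ, hζ⟩ := HasEnoughRootsOfUnity.prim (M := AlgebraicClosure F) (n := p)
  have hfix : ζ ∈ (⊥ : IntermediateField F (AlgebraicClosure F)) := by
    rw [InfiniteGalois.mem_bot_iff_fixed]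
    intro f
    have h1 : (absoluteGaloisGroup.toAlgEquiv F).symm f = 1 := hall _
    rw [MulEquiv.symm_apply_eq, map_one] at h1
    rw [h1]
    rfl
  obtain ⟨y, hy⟩ := IntermediateField.mem_bot.mp hfix
  have hy' : IsPrimitiveRoot y p :=
    IsPrimitiveRoot.of_map_of_injective (f := algebraMap F (AlgebraicClosure F))
      (by rw [hy]; exact hζ) (algebraMap F (AlgebraicClosure F)).injective
  have h1 := Polynomial.cyclotomic_eq_minpoly_rat hy' hp.pos
  have h2 := minpoly.natDegree_le (A := ℚ) y
  rw [← h1, Polynomial.natDegree_cyclotomic, Nat.totient_prime hp] at h2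
  omega

namespace FundamentalExtension

/-- **[AbsTopI] Thm 2.6 (vi)**, first typed sentence, the printed deduction kernel-checked:
GIVEN [AbsAnab] Thm 1.1.2 (`galoisNF_tfgNormalSubgroup_trivial`), for every extension
`1 → Δ → Π → G_F → 1` (`F` a number field) with `Δ` topologically finitely generated, `Δ` is the
maximal topologically finitely generated closed normal subgroup of `Π` (the case `Π′ = Π` of
[AbsAnab] Lemma 1.1.4 (i)). [cite: MochizukiAbsTopI2012, Thm 2.6 (vi) p.22] -/
theorem thm26_vi_maximal_of_tfgNormalSubgroup_trivial
    (h112 : galoisNF_tfgNormalSubgroup_trivial) : thm26_vi_maximal := by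
  intro E B hΔ
  refine geomIsMaxTFGNormalIn_of_tfgNormalSubgroup_trivial h112 E B hΔ ⊤ ?_
  rw [Subgroup.coe_top]
  exact isOpen_univ

/-- **[AbsTopI] Thm 2.6 (vi)** "In particular, `Π` is not topologically finitely generated" — the
printed deduction kernel-checked: GIVEN [AbsAnab] Thm 1.1.2 (`galoisNF_tfgNormalSubgroup_trivial`),
no extension `1 → Δ → Π → G_F → 1` with `F` a number field has `Π` topologically finitely
generated (else `G_F`, a quotient of `Π`, would be a tfg closed normal subgroup of itself, hence
trivial — but `G_F ≠ 1`). [cite: MochizukiAbsTopI2012, Thm 2.6 (vi) p.22] -/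
theorem thm26_vi_not_tfg_of_tfgNormalSubgroup_trivial
    (h112 : galoisNF_tfgNormalSubgroup_trivial) : thm26_vi_not_tfg := by
  intro E B hPi
  letI := B.instField
  letI := B.instNumberField
  -- `G_F` is topologically finitely generated, hence so is its subgroup `⊤`
  have hG : IsTopologicallyFinitelyGenerated (absoluteGaloisGroup B.F) :=
    (hPi.of_surjective E.aug E.aug_surjective).of_continuousMulEquiv B.galIso
  let eTop : absoluteGaloisGroup B.F ≃ₜ* (⊤ : Subgroup (absoluteGaloisGroup B.F)) :=
    { Subgroup.topEquiv.symm with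
      continuous_toFun := Continuous.subtype_mk continuous_id _
      continuous_invFun := continuous_subtype_val }
  have hTop : IsTopologicallyFinitelyGenerated (⊤ : Subgroup (absoluteGaloisGroup B.F)) :=
    hG.of_continuousMulEquiv eTop
  -- Theorem 1.1.2 applied to `N = G_F` itself
  have htriv : (⊤ : Subgroup (absoluteGaloisGroup B.F)) = ⊥ :=
    h112 B.F ⊤ inferInstance (by rw [Subgroup.coe_top]; exact isClosed_univ) hTop.exists_finset
  obtain ⟨σ, hσ⟩ := exists_ne_one_absoluteGaloisGroup B.F
  have hmem : σ ∈ (⊤ : Subgroup (absoluteGaloisGroup B.F)) := Subgroup.mem_top σ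
  rw [htriv, Subgroup.mem_bot] at hmem
  exact hσ hmem

end FundamentalExtension

end Literature.AnabelianGeometry.AbsoluteAnabelian
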